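/-
HODGE LADDER — STAGE 4, §0-bis of the scoping document: the STRICT road's record
`HodgeTheory.Arapura2006_hodgeClasses_algebraic_of_isDominatedByPowers` (Arapura 2006 Lemma 4.2, HC clause, algebraic
form of Lemma 1.1) PROVED IN THE KERNEL for the dominated variety itself.  Literature seat hodge-director-lit-stage4,
gen 7; companion document run/shared/lean/pub/hodge-director/STAGE4-ABELIAN-MOTIVIC-TYPE.md (v7).  Theorems only.
Summits-side because the multiplicativity `Voisin2003_cupProduct_algebraicClasses_holds` is proved under Summits/.
-/
import Summits.HodgeConjecture.HodgeConjecture.Theorems.EndoscopicMiddleDegreeCupProductAlgebraic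
import Summits.HodgeConjecture.HodgeConjecture.Theorems.Ring2AbelianAllAndreCorrespondenceCategory
import Summits.HodgeConjecture.CorCM.Stage4StrictAbelianType
import Literature.AlgebraicGeometry.HodgeTheory.DominatedByPowersHodgeConjecture
import Literature.AlgebraicGeometry.HodgeTheory.HodgeClassLiftRationalHodgeMaps
import Literature.AlgebraicGeometry.HodgeTheory.GysinHodgeClassLiftProofs
import Literature.AlgebraicGeometry.HodgeTheory.MotivatedClassesRationalSpan
import Literature.AlgebraicGeometry.HodgeTheory.MotivatedClassesProofs
import Literature.AlgebraicGeometry.HodgeTheory.AlgebraicClassesHodgeTypeHolds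
import Literature.AlgebraicGeometry.HodgeTheory.ComplexOrientationCycleClassFacts
import Literature.AlgebraicGeometry.HodgeTheory.HodgeTypeExteriorProduct
import Literature.AlgebraicGeometry.HodgeTheory.HodgeTypeConjugation
import Literature.NumberTheory.Transcendental.DeRhamTheoremMultiplicative
import HarnessLib

/-!
# Stage 4, §0-bis: Arapura's Lemma 4.2 (HC clause, algebraic form) for the dominated variety itself — PROVED

D. Arapura, *Motivation for Hodge cycles*, Adv. Math. 207 (2006), Lemma 4.2: "Suppose that `X` and `Y` are
smooth projective varieties such that `Y` is motivated by `X`. If `X` and all its powers satisfies one of the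
conjectures (`D`, `B`, `HC`, `GHC`) stated above, then the same conjecture holds for `Y` and all its powers."
The tree records the `HC` clause, with "motivated by `X`" in the algebraic form of Lemma 1.1
(`HodgeTheory.IsDominatedByPowers`), as the named fact `HodgeTheory.Arapura2006_hodgeClasses_algebraic_of_isDominatedByPowers`
(`Literature/…/HodgeTheory/DominatedByPowersHodgeConjecture`), consumed by every "strict road" wiring of
`CorCM/Stage4StrictAbelianType`.  This file PROVES its first conjunct — the Hodge conjecture for `Y` itself —
by the printed argument (Arapura §1/§4; Floccari–Varesco 2024 Rem. 2.2): a rational `(p,p)`-class `c` of `Y`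
lies in a finite sum of images of algebraic correspondences `(γᵢ)_* : H^{2dᵢ}(X^{eᵢ}) → H^{2p}(Y)` with `γᵢ`
RATIONAL algebraic (the algebraic classes are the `ℂ`-span of the rational ones) acting through the complex
orientations; each is a morphism of rational Hodge structures up to an (integer) Tate twist (pull-back, cup
product with a class of type `(c, c)`, Gysin morphism: Voisin I §7.3.2, Lemma 11.41); polarisable rational Hodge
structures being semisimple (Voisin 2025 Prop. 2.11 / Cor. 2.12; the tree's `HodgeClassLiftRationalHodgeMaps`),
`c = Σᵢ (γᵢ)_* aᵢ` with `aᵢ` rational of type `(dᵢ, dᵢ)`, algebraic by the Hodge conjecture for `X^{eᵢ}`, and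
`(γᵢ)_*` preserves algebraic classes (pull-back, `Voisin2003_cupProduct_algebraicClasses_holds`, push-forward).

Content (theorems only; no definition, no named fact): §1 `HodgeModel.map_baseChange_hodgeStructure_F_le_of_hodgeType_int`,
`exists_isRationalClass_isOfHodgeType_eq_sum_int` — Cor. 2.12 for a finite family of rational Hodge-linear maps
with INTEGER Tate twists (the tree's `exists_isRationalClass_isOfHodgeType_eq_sum` is the case of non-negative
twists; negative twists occur for correspondences and kill the types they cannot shift); §2 `γ_*` is such a map
(`isRationalClass_corrAction_complex`, `isOfHodgeType_corrAction_complex`, `corrAction_eq_zero_of_hodgeType_lt`,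
`corrAction_mem_algebraicClasses_complex`); §3 `hodgeConjectureFor_of_dim_zero`, `hodgeConjectureFor_pow_of_succ`,
`span_rationalAlgebraicCorrRanges_eq_top`, **`hodgeConjectureFor_of_isDominatedByPowers`** (the first conjunct of
the record, PROVED), `hc_of_isDominatedByPowers_abelianVariety_self` (`HC_AV` alone ⟹ HC for every variety
dominated by the powers of an abelian variety).  NOT here: the record's second conjunct (the powers `Y^{m+1}`),
which needs external products of algebraic correspondences on the real carriers; the record stays a named fact.

References: Arapura2006 (§1 Lemma 1.1, §4 Lemma 4.2); Voisin2025 (Prop. 2.11, Cor. 2.12, §2.1); VoisinHodgeI2002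
(§7.1.1, §7.3.2, §11.3.3 Lemma 11.41, Prop. 11.20); VoisinHodgeII2003 (§9.2.4 Prop. 9.20–9.21, (10.7));
FloccariVaresco2024 (Rem. 2.2); Andre1996Motifs (§2.1).
-/

noncomputable section

namespace Summit.HodgeConjecture.CorCM.Stage4

open CategoryTheory MonoidalCategory CartesianMonoidalCategory
open scoped TensorProduct Manifold ContDiff
open Literature.AlgebraicGeometry Literature.AlgebraicGeometry.Motives Literature.AlgebraicGeometry.HodgeTheory
open Literature.AlgebraicTopology.SingularHomology
open Summit.HodgeConjecture.HodgeConjecture.Theorems (Voisin2003_cupProduct_algebraicClasses_holds)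

/-! ## §1 Cor. 2.12 for rational Hodge-linear maps with INTEGER Tate twists -/

section Engine

variable {m n : ℕ} {Y X : SchemeOver ℂ}

/-- **A rational map shifting Hodge types by an integer `s` — and killing the types it cannot shift — has
bidegree `(s, s)` for the Hodge filtrations** of the Hodge structures of Hodge symmetric models (Voisin 2025 §2.1
"Tate twist"; Voisin I §7.3.2): `G : Hᵃ(Y(ℂ); ℂ) → Hᵇ(X(ℂ); ℂ)`, `a + 2s = b`, sends type `(p, q)` to type
`(p + s, q + s)` when both are `≥ 0` (`hGtyp`), to `0` otherwise (`hGkill`), and `G (ι y) = ι (ψ y)`.  Proof as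
the tree's `HodgeModel.map_baseChange_hodgeStructure_F_le` / `…_of_hodgeType`. [cite: Voisin2025, §2.1 (p. 23)]
[cite: VoisinHodgeI2002, §7.1.1 Def. 7.4 and §7.3.2] -/
theorem HodgeModel.map_baseChange_hodgeStructure_F_le_of_hodgeType_int
    (hI : hodgePQ_independent_of_hodgeModel) (hY : IsSmoothProjective m Y)
    (hX : IsSmoothProjective n X) (B : HodgeModel m Y) (A : HodgeModel n X)
    (hB : B.IsHodgeSymmetric) (hA : A.IsHodgeSymmetric) {a b : ℕ} (s : ℤ) (hab : (a : ℤ) + 2 * s = b)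
    (G : complexBetti Y a →ₗ[ℂ] complexBetti X b)
    (hGtyp : ∀ ⦃p q : ℕ⦄ ⦃y : complexBetti Y a⦄, p + q = a → IsOfHodgeType m Y a p q y →
      ∀ ⦃p' q' : ℕ⦄, (p' : ℤ) = p + s → (q' : ℤ) = q + s → IsOfHodgeType n X b p' q' (G y))
    (hGkill : ∀ ⦃p q : ℕ⦄ ⦃y : complexBetti Y a⦄, p + q = a → IsOfHodgeType m Y a p q y →
      ((p : ℤ) + s < 0 ∨ (q : ℤ) + s < 0) → G y = 0)
    (ψ : singularCohomology ℚ ℚ (ComplexPoints Y) a →ₗ[ℚ] singularCohomology ℚ ℚ (ComplexPoints X) b)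
    (hψ : ∀ y, G (singularCohomology.ringChange (algebraMap ℚ ℂ) (ComplexPoints Y) a y) =
      singularCohomology.ringChange (algebraMap ℚ ℂ) (ComplexPoints X) b (ψ y)) (r : ℤ) :
    ((B.hodgeStructure hY hB a).F r).map (ψ.baseChange ℂ) ≤
      (A.hodgeStructure hX hA b).F (r + s) := by
  rintro _ ⟨t, ht, rfl⟩
  rw [SetLike.mem_coe, HodgeModel.hodgeStructure_F, HodgeModel.ratF_eq_iSup] at ht
  rw [HodgeModel.hodgeStructure_F, HodgeModel.ratF_eq_iSup]
  induction ht using Submodule.iSup_induction' with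
  | mem pq t ht =>
    by_cases hr : r ≤ (pq.1.1 : ℤ)
    · rw [iSup_pos hr, HodgeModel.mem_ratPiece_iff, HodgeModel.complexification_apply] at ht
      have hpq : pq.1.1 + pq.1.2 = a := Finset.HasAntidiagonal.mem_antidiagonal.1 pq.2
      -- `G (β t) = β ((ψ ⊗ ℂ) t)`
      have key := apply_ofRatClassBaseChange_eq_smul G ψ 1
        (fun y ↦ by rw [one_smul]; exact hψ y) t
      rw [one_smul] at key
      have hty : IsOfHodgeType m Y a pq.1.1 pq.1.2 (ofRatClassBaseChange (ComplexPoints Y) a t) :=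
        ⟨B, ht⟩
      by_cases hlt : (pq.1.1 : ℤ) + s < 0 ∨ (pq.1.2 : ℤ) + s < 0
      · -- the shifted type does not exist: `G (β t) = 0`, so `(ψ ⊗ ℂ) t = 0`
        have h0 : G (ofRatClassBaseChange (ComplexPoints Y) a t) = 0 := hGkill hpq hty hlt
        rw [h0] at key
        have ht0 : ψ.baseChange ℂ t = 0 :=
          ofRatClassBaseChange_injective _ b (by rw [map_zero]; exact key.symm)
        rw [ht0]
        exact Submodule.zero_mem _
      · -- the shifted type `(p', q')`
        push Not at hlt
        obtain ⟨p', hp'⟩ : ∃ p' : ℕ, (p' : ℤ) = pq.1.1 + s := ⟨(pq.1.1 + s).toNat, Int.toNat_of_nonneg hlt.1⟩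
        obtain ⟨q', hq'⟩ : ∃ q' : ℕ, (q' : ℤ) = pq.1.2 + s := ⟨(pq.1.2 + s).toNat, Int.toNat_of_nonneg hlt.2⟩
        have htyp : IsOfHodgeType n X b p' q' (G (ofRatClassBaseChange (ComplexPoints Y) a t)) :=
          hGtyp hpq hty hp' hq'
        rw [key, hI.isOfHodgeType_iff hX A] at htyp
        have hsum : p' + q' = b := by omega
        have hanti : (p', q') ∈ Finset.HasAntidiagonal.antidiagonal b :=
          Finset.HasAntidiagonal.mem_antidiagonal.2 hsum
        refine Submodule.mem_iSup_of_mem ⟨(p', q'), hanti⟩ (Submodule.mem_iSup_of_mem ?_ ?_)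
        · change r + s ≤ (p' : ℤ)
          omega
        · rw [HodgeModel.mem_ratPiece_iff, HodgeModel.complexification_apply]
          exact htyp
    · rw [iSup_neg hr, Submodule.mem_bot] at ht
      rw [ht, map_zero]
      exact Submodule.zero_mem _
  | zero => rw [map_zero]; exact Submodule.zero_mem _
  | add x y _ _ hx hy => rw [map_add]; exact Submodule.add_mem _ hx hy

/-- **Hodge classes lift along a finite family of rational Hodge-linear maps with INTEGER Tate twists**
(Voisin 2025, Cor. 2.12 for `Σⱼ G j : ⊕ⱼ H^{2dⱼ}(Y j)(−sⱼ) → H^{2q}(X)`), UNCONDITIONALLY: `dⱼ + sⱼ = q`, `sⱼ ∈ ℤ`,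
`G j` carrying rational classes to rational classes, type `(a, b)` to type `(a + sⱼ, b + sⱼ)` when both are
`≥ 0` and to `0` otherwise; then a rational `(q, q)`-class in `Σⱼ im (G j)` is `Σⱼ G j (a j)` with `a j` rational
of type `(dⱼ, dⱼ)`.  The tree's `exists_isRationalClass_isOfHodgeType_eq_sum_of_hodgeStructures` (integer twists)
with real models (`exists_isReal_hodgeModel_holds`), `smoothProjective_hodgeStructure_isPolarizable_holds`,
`exists_ratLinearMap_of_isRationalClass` and §1. [cite: Voisin2025, Cor. 2.12, Prop. 2.11, §2.1 and proof of Prop. 3.8]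
[cite: VoisinHodgeI2002, Thm. 6.32, §7.1.1, §7.1.2, Lemma 7.26 and §7.3.2] -/
theorem exists_isRationalClass_isOfHodgeType_eq_sum_int
    (hX : IsSmoothProjective n X) {ι : Type} [Fintype ι] {m d : ι → ℕ}
    {Y : ι → SchemeOver ℂ} (hY : ∀ j, IsSmoothProjective (m j) (Y j)) (q : ℕ)
    (s : ι → ℤ) (hs : ∀ j, (d j : ℤ) + s j = q)
    (G : ∀ j, complexBetti (Y j) (2 * d j) →ₗ[ℂ] complexBetti X (2 * q))
    (hGrat : ∀ j y, IsRationalClass y → IsRationalClass (G j y))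
    (hGtyp : ∀ j ⦃p q' : ℕ⦄ ⦃y : complexBetti (Y j) (2 * d j)⦄, p + q' = 2 * d j →
      IsOfHodgeType (m j) (Y j) (2 * d j) p q' y →
        ∀ ⦃p₁ q₁ : ℕ⦄, (p₁ : ℤ) = p + s j → (q₁ : ℤ) = q' + s j →
          IsOfHodgeType n X (2 * q) p₁ q₁ (G j y))
    (hGkill : ∀ j ⦃p q' : ℕ⦄ ⦃y : complexBetti (Y j) (2 * d j)⦄, p + q' = 2 * d j →
      IsOfHodgeType (m j) (Y j) (2 * d j) p q' y → ((p : ℤ) + s j < 0 ∨ (q' : ℤ) + s j < 0) → G j y = 0)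
    {c : complexBetti X (2 * q)} (hc : IsRationalClass c) (hc' : IsOfHodgeType n X (2 * q) q q c)
    (hcg : c ∈ ⨆ j, LinearMap.range (G j)) :
    ∃ a : ∀ j, complexBetti (Y j) (2 * d j),
      (∀ j, IsRationalClass (a j) ∧ IsOfHodgeType (m j) (Y j) (2 * d j) (d j) (d j) (a j)) ∧
        c = ∑ j, G j (a j) := by
  have hI : hodgePQ_independent_of_hodgeModel := hodgePQ_independent_of_hodgeModel_holds
  -- real, hence Hodge symmetric, Hodge models
  obtain ⟨A, hA⟩ := exists_isReal_hodgeModel_holds n X hX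
  have hB' : ∀ j, ∃ B : HodgeModel (m j) (Y j), B.IsReal :=
    fun j ↦ exists_isReal_hodgeModel_holds (m j) (Y j) (hY j)
  choose B hB using hB'
  -- the maps are defined over `ℚ`
  have hψ' : ∀ j, ∃ ψ : singularCohomology ℚ ℚ (ComplexPoints (Y j)) (2 * d j) →ₗ[ℚ]
      singularCohomology ℚ ℚ (ComplexPoints X) (2 * q),
      ∀ y, G j (singularCohomology.ringChange (algebraMap ℚ ℂ) (ComplexPoints (Y j)) (2 * d j) y) =
        singularCohomology.ringChange (algebraMap ℚ ℂ) (ComplexPoints X) (2 * q) (ψ y) :=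
    fun j ↦ exists_ratLinearMap_of_isRationalClass (G j) (hGrat j)
  choose ψ hψ using hψ'
  refine exists_isRationalClass_isOfHodgeType_eq_sum_of_hodgeStructures hY q G
    (A.hodgeStructure hX hA.isHodgeSymmetric (2 * q))
    (fun j ↦ (B j).hodgeStructure (hY j) (hB j).isHodgeSymmetric (2 * d j))
    (fun j ↦ smoothProjective_hodgeStructure_isPolarizable_holds (hY j) (B j)
      (hB j).isHodgeSymmetric (2 * d j))
    (fun x hx ↦ (A.mem_hodgeClasses_iff_isOfHodgeType_ringChange hX hI hA.isHodgeSymmetric q x).2 hx)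
    (fun j y hy ↦ ((B j).mem_hodgeClasses_iff_isOfHodgeType_ringChange (hY j) hI
      (hB j).isHodgeSymmetric (d j) y).1 hy)
    s (fun j ↦ by have := hs j; omega) ψ (fun j p ↦ ?_) hψ hc hc' hcg
  exact HodgeModel.map_baseChange_hodgeStructure_F_le_of_hodgeType_int hI (hY j) hX (B j) A
    (hB j).isHodgeSymmetric hA.isHodgeSymmetric (s j) (by have := hs j; push_cast; omega) (G j)
    (hGtyp j) (hGkill j) (ψ j) (hψ j) p

end Engine

/-! ## §2 The action of a rational class of type `(c, c)` for the complex orientations is a rational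
Hodge-linear map with Tate twist `c − dim`, killing the types it cannot shift -/

section CorrAction

variable {n N : ℕ} {Y Z : SchemeOver ℂ}

/-- **`γ_*` preserves rational classes** (`γ` rational, complex orientations): pull-back and cup product
preserve rationality, and so do the Gysin morphisms of the complex orientation family
(`isRationalClass_complexGysin_complexOrientationFamily`). [cite: VoisinHodgeI2002, §7.3.2 and §11.3.3 Lemma 11.41] -/
theorem isRationalClass_corrAction_complex (hY : IsSmoothProjective n Y) (hZ : IsSmoothProjective N Z)
    {c a b : ℕ} (hab : a + 2 * c = b + 2 * N) {γ : complexBetti (Y ⊗ Z) (2 * c)}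
    (hγ : IsRationalClass γ) {y : complexBetti Z a} (hy : IsRationalClass y) :
    IsRationalClass (corrAction complexOrientationFamily hY hZ hab γ y) := by
  rw [corrAction_apply]
  exact isRationalClass_complexGysin_complexOrientationFamily (IsSmoothProjective.tensor_holds hY hZ) hY
    (fst Y Z) _ (IsRationalClass.cup rfl (hy.map _) hγ)

/-- **`γ_*` has bidegree `(c − dim Z, c − dim Z)` on Hodge types for `γ` of type `(c, c)`** (pull-back
preserves types, `∪ γ` adds `(c, c)`, `pr_{Y*}` shifts by `−dim Z`). [cite: VoisinHodgeI2002, §7.3.2 and §11.3.3 Lemma 11.41] -/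
theorem isOfHodgeType_corrAction_complex (hY : IsSmoothProjective n Y) (hZ : IsSmoothProjective N Z)
    {c a b : ℕ} (hab : a + 2 * c = b + 2 * N) {γ : complexBetti (Y ⊗ Z) (2 * c)}
    (hγ : IsOfHodgeType (n + N) (Y ⊗ Z) (2 * c) c c γ) {p q p' q' : ℕ} (hp : p' + N = p + c)
    (hq : q' + N = q + c) {y : complexBetti Z a} (hy : IsOfHodgeType N Z a p q y) :
    IsOfHodgeType n Y b p' q' (corrAction complexOrientationFamily hY hZ hab γ y) := by
  have hYZ := IsSmoothProjective.tensor_holds hY hZ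
  have hcup : IsOfHodgeType (n + N) (Y ⊗ Z) (a + 2 * c) (p + c) (q + c)
      (cupProduct (rfl : a + 2 * c = a + 2 * c) (complexBetti.map (snd Y Z) a y) γ) :=
    cupPreservesHodgeType_of_multiplicative_deRham
      (fun E _ _ _ ↦ Literature.NumberTheory.Transcendental.exists_deRhamIsoFamily_holds E) hYZ
      rfl (hy.map_of_isSmoothProjective hYZ hZ (snd Y Z)) hγ
  rw [corrAction_apply]
  exact isOfHodgeType_complexGysin hodgePQ_independent_of_hodgeModel_holds
    (fun _ _ ↦ nonempty_hodgeModel_holds)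
    (fun E _ _ _ ↦ Literature.NumberTheory.Transcendental.exists_deRhamIsoFamily_holds E)
    complexOrientationFamily hYZ hY (fst Y Z) _ (by omega) (by omega) hcup

/-- **`γ_*` kills the Hodge types it cannot shift**: for `γ` of type `(c, c)` and `y` of type `(p, q)` with
`p + c < dim Z` (or `q + c`), `γ_* y = 0` (`complexGysin_eq_zero_of_hodgeType_of_lt` for `pr_Y`). [cite: VoisinHodgeI2002, §7.3.2 (with Lemma 7.30)] -/
theorem corrAction_eq_zero_of_hodgeType_lt (hY : IsSmoothProjective n Y) (hZ : IsSmoothProjective N Z)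
    {c a b : ℕ} (hab : a + 2 * c = b + 2 * N) {γ : complexBetti (Y ⊗ Z) (2 * c)}
    (hγ : IsOfHodgeType (n + N) (Y ⊗ Z) (2 * c) c c γ) {p q : ℕ} (hpq : p + c < N ∨ q + c < N)
    {y : complexBetti Z a} (hy : IsOfHodgeType N Z a p q y) :
    corrAction complexOrientationFamily hY hZ hab γ y = 0 := by
  have hI : hodgePQ_independent_of_hodgeModel := hodgePQ_independent_of_hodgeModel_holds
  have hYZ := IsSmoothProjective.tensor_holds hY hZ
  obtain ⟨B⟩ := nonempty_hodgeModel_holds (n := n + N) (X := Y ⊗ Z) hYZ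
  obtain ⟨A⟩ := nonempty_hodgeModel_holds (n := n) (X := Y) hY
  have hcup : IsOfHodgeType (n + N) (Y ⊗ Z) (a + 2 * c) (p + c) (q + c)
      (cupProduct (rfl : a + 2 * c = a + 2 * c) (complexBetti.map (snd Y Z) a y) γ) :=
    cupPreservesHodgeType_of_multiplicative_deRham
      (fun E _ _ _ ↦ Literature.NumberTheory.Transcendental.exists_deRhamIsoFamily_holds E) hYZ
      rfl (hy.map_of_isSmoothProjective hYZ hZ (snd Y Z)) hγ
  rw [corrAction_apply]
  exact complexGysin_eq_zero_of_hodgeType_of_lt hI complexOrientationFamily hYZ hY B A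
    (cupPreservesHodgeType_of_multiplicative_deRham
      (fun E _ _ _ ↦ Literature.NumberTheory.Transcendental.exists_deRhamIsoFamily_holds E) hYZ)
    (cupPreservesHodgeType_of_multiplicative_deRham
      (fun E _ _ _ ↦ Literature.NumberTheory.Transcendental.exists_deRhamIsoFamily_holds E) hY)
    (fst Y Z) _ (by omega) ((isOfHodgeType_iff_mem_hodgePQ hYZ B _).1 hcup)

/-- **`γ_*` carries algebraic classes to algebraic classes** for `γ` algebraic and the complex orientations
(flat pull-back, the PROVED multiplicativity `Voisin2003_cupProduct_algebraicClasses_holds`, proper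
push-forward: the tree's `corrClassAction_mem_algebraicClasses_of_cupProduct`), in degrees `2p' ≤ 2 dim Y`.
[cite: VoisinHodgeII2003, §9.2.4 Prop. 9.20 and Prop. 9.21] -/
theorem corrAction_mem_algebraicClasses_complex (hY : IsSmoothProjective n Y) (hZ : IsSmoothProjective N Z)
    {c d p' k : ℕ} (hab : 2 * d + 2 * c = 2 * p' + 2 * N) (hk : 2 * p' + k = 2 * n)
    {γ : complexBetti (Y ⊗ Z) (2 * c)} (hγ : γ ∈ algebraicClasses (Y ⊗ Z) c)
    {z : complexBetti Z (2 * d)} (hz : z ∈ algebraicClasses Z d) :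
    corrAction complexOrientationFamily hY hZ hab γ z ∈ algebraicClasses Y p' := by
  have hYZ := IsSmoothProjective.tensor_holds hY hZ
  rw [corrAction_eq_corrClassAction complexOrientationFamily hY hZ hab hk]
  exact corrClassAction_mem_algebraicClasses_of_cupProduct hY hZ _ _
    (complexOrientationFamily.hasPoincareDuality hY) hab hk
    (fun _ _ hx hy ↦ Voisin2003_cupProduct_algebraicClasses_holds hYZ hx hy) hγ hz

end CorrAction

/-! ## §3 The Hodge conjecture for a variety dominated by the powers of `X` -/

section Dominated

variable {dX dY : ℕ} {X Y : SchemeOver ℂ}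

/-- **The Hodge conjecture in dimension `0`** (the point `X⁰ = Spec ℂ`): a Hodge model exists
(`nonempty_hodgeModel_holds`), `N⁰ H⁰ = H⁰`, and `H^{2d} = 0` for `d ≥ 1`. [cite: VoisinHodgeI2002, §11.3] -/
theorem hodgeConjectureFor_of_dim_zero {P : SchemeOver ℂ} (hP : IsSmoothProjective 0 P) :
    HodgeConjectureFor 0 P := by
  refine ⟨nonempty_hodgeModel_holds hP, fun d z _ _ ↦ ?_⟩
  cases d with
  | zero => exact hodgeConjectureFor_codim_zero z
  | succ d =>
    haveI := subsingleton_complexBetti hP (k := 2 * (d + 1)) (by omega)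
    rw [Subsingleton.elim z 0]
    exact Submodule.zero_mem _

/-- The Hodge conjecture for ALL cartesian powers `Xᵉ`, `e ≥ 0`, from the positive ones (the power `X⁰`
is a point). [cite: Arapura2006, Lemma 4.2] -/
theorem hodgeConjectureFor_pow_of_succ (hX : IsSmoothProjective dX X)
    (hpow : ∀ m : ℕ, HodgeConjectureFor ((m + 1) * dX) (X.pow (m + 1))) :
    ∀ e : ℕ, HodgeConjectureFor (e * dX) (X.pow e)
  | 0 => by
    have h0 : IsSmoothProjective (0 * dX) (X.pow 0) := hX.pow 0
    rw [Nat.zero_mul] at h0 ⊢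
    exact hodgeConjectureFor_of_dim_zero h0
  | e + 1 => hpow e

/-- **Domination may be witnessed by RATIONAL algebraic classes acting through the COMPLEX orientations**:
`H^{2p}(Y(ℂ); ℂ)` is the `ℂ`-span of the images of the `γ_* = corrAction complexOrientationFamily …`, `γ` rational
algebraic on `Y ⊗ Xᵉ` (every algebraic correspondence is such a `γ_*` with `γ` algebraic, ring 2's
`IsAlgebraicCorrespondence.exists_eq_corrAction`; algebraic classes are spanned by the rational ones,
`algebraicClasses_le_span_isRationalClass`; `γ ↦ γ_* x` is linear). [cite: Arapura2006, §1 Lemma 1.1] -/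
theorem span_rationalAlgebraicCorrRanges_eq_top (hX : IsSmoothProjective dX X) (hY : IsSmoothProjective dY Y)
    (hdom : IsDominatedByPowers dY Y dX X) (p : ℕ) :
    Submodule.span ℂ
        {c : complexBetti Y (2 * p) |
          ∃ (e cd d : ℕ) (hab : 2 * d + 2 * cd = 2 * p + 2 * (e * dX))
            (γ : complexBetti (Y ⊗ X.pow e) (2 * cd)),
            IsRationalClass γ ∧ γ ∈ algebraicClasses (Y ⊗ X.pow e) cd ∧
              c ∈ LinearMap.range (corrAction complexOrientationFamily hY (hX.pow e) hab γ)} = ⊤ := by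
  refine eq_top_iff.2 ((hdom (2 * p)).symm.le.trans (Submodule.span_le.2 ?_))
  rintro c ⟨e, a, T, hT, ⟨x, rfl⟩⟩
  obtain ⟨cd, hab, γ, hγ, rfl⟩ :=
    Summit.HodgeConjecture.HodgeConjecture.Ring2.AbelianAll.IsAlgebraicCorrespondence.exists_eq_corrAction
      hY (hX.pow e) hT
  obtain ⟨d, rfl⟩ : ∃ d, a = 2 * d := ⟨a / 2, by omega⟩
  have hYXe := IsSmoothProjective.tensor_holds hY (hX.pow e)
  -- `γ ↦ γ_* x` is linear and `γ` is a `ℂ`-combination of rational algebraic classes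
  have hγ' := algebraicClasses_le_span_isRationalClass hYXe cd hγ
  have hlin : corrAction complexOrientationFamily hY (hX.pow e) hab γ x =
      ((corrAction complexOrientationFamily hY (hX.pow e) hab).flip x) γ := by
    rw [LinearMap.flip_apply]
  rw [SetLike.mem_coe, hlin]
  have hmem : ((corrAction complexOrientationFamily hY (hX.pow e) hab).flip x) γ ∈
      (Submodule.span ℂ {g : complexBetti (Y ⊗ X.pow e) (2 * cd) |
          IsRationalClass g ∧ g ∈ algebraicClasses (Y ⊗ X.pow e) cd}).map
        ((corrAction complexOrientationFamily hY (hX.pow e) hab).flip x) :=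
    Submodule.mem_map_of_mem hγ'
  rw [Submodule.map_span] at hmem
  refine Submodule.span_mono ?_ hmem
  rintro _ ⟨g, ⟨hg₁, hg₂⟩, rfl⟩
  exact ⟨e, cd, d, hab, g, hg₁, hg₂, x, by rw [LinearMap.flip_apply]⟩

/-- **Arapura 2006, Lemma 4.2 (HC clause, algebraic form) for the dominated variety itself — PROVED**: for
`X`, `Y` smooth projective over `ℂ` with `IsDominatedByPowers dY Y dX X`, the Hodge conjecture for all positive
cartesian powers `X^{m+1}` implies the Hodge conjecture for `Y` — the first conjunct of the record
`HodgeTheory.Arapura2006_hodgeClasses_algebraic_of_isDominatedByPowers`, no hypothesis left (module docstring: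
finitely many rational algebraic `(γᵢ)_*` carry the class; §1 with twists `dᵢ + cdᵢ − eᵢ·dX = p` writes it as
`Σᵢ (γᵢ)_* aᵢ`, `aᵢ` rational of type `(dᵢ, dᵢ)`, algebraic by HC for `X^{eᵢ}` (a point for `eᵢ = 0`), and
`(γᵢ)_*` preserves algebraic classes). [cite: Arapura2006, Lemma 4.2 and Lemma 1.1 (§4, §1)]
[cite: Voisin2025, Cor. 2.12] [cite: FloccariVaresco2024, Rem. 2.2] -/
theorem hodgeConjectureFor_of_isDominatedByPowers (hX : IsSmoothProjective dX X)
    (hY : IsSmoothProjective dY Y) (hdom : IsDominatedByPowers dY Y dX X)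
    (hpow : ∀ m : ℕ, HodgeConjectureFor ((m + 1) * dX) (X.pow (m + 1))) :
    HodgeConjectureFor dY Y := by
  classical
  refine ⟨nonempty_hodgeModel_holds hY, fun p c hc hpp ↦ ?_⟩
  -- degrees beyond `2 dim Y`: nothing to prove
  by_cases hp : 2 * dY < 2 * p
  · haveI := subsingleton_complexBetti hY hp
    rw [Subsingleton.elim c 0]
    exact Submodule.zero_mem _
  obtain ⟨k, hk⟩ : ∃ k, 2 * p + k = 2 * dY := ⟨2 * dY - 2 * p, by omega⟩
  have hpow' := hodgeConjectureFor_pow_of_succ hX hpow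
  -- a finite family of rational algebraic correspondences carrying `c`
  have hc1 := (span_rationalAlgebraicCorrRanges_eq_top hX hY hdom p).symm ▸ Submodule.mem_top (x := c)
  obtain ⟨T, hTS, hcT⟩ := Submodule.mem_span_finite_of_mem_span hc1
  have hdata : ∀ t : T, ∃ (e cd d : ℕ) (hab : 2 * d + 2 * cd = 2 * p + 2 * (e * dX))
      (γ : complexBetti (Y ⊗ X.pow e) (2 * cd)),
      IsRationalClass γ ∧ γ ∈ algebraicClasses (Y ⊗ X.pow e) cd ∧
        (t : complexBetti Y (2 * p)) ∈
          LinearMap.range (corrAction complexOrientationFamily hY (hX.pow e) hab γ) :=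
    fun t ↦ hTS t.2
  choose e cd d hab γ hγr hγa hγt using hdata
  -- the engine of §1 for the family `(γ t)_*`, twists `cd t − e t · dX`
  obtain ⟨a, ha, hsum⟩ := exists_isRationalClass_isOfHodgeType_eq_sum_int hY
    (ι := T) (m := fun t ↦ e t * dX) (d := d) (Y := fun t ↦ X.pow (e t)) (fun t ↦ hX.pow (e t)) p
    (fun t ↦ (cd t : ℤ) - (e t * dX : ℕ)) (fun t ↦ by have := hab t; push_cast; omega)
    (fun t ↦ corrAction complexOrientationFamily hY (hX.pow (e t)) (hab t) (γ t))
    (fun t y hy ↦ isRationalClass_corrAction_complex hY (hX.pow (e t)) (hab t) (hγr t) hy)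
    (fun t p₀ q₀ y _ hy p₁ q₁ hp₁ hq₁ ↦ isOfHodgeType_corrAction_complex hY (hX.pow (e t)) (hab t)
      (isOfHodgeType_of_mem_algebraicClasses_of_isSmoothProjective
        (IsSmoothProjective.tensor_holds hY (hX.pow (e t))) (cd t) (hγa t))
      (by push_cast at hp₁; omega) (by push_cast at hq₁; omega) hy)
    (fun t p₀ q₀ y _ hy hlt ↦ corrAction_eq_zero_of_hodgeType_lt hY (hX.pow (e t)) (hab t)
      (isOfHodgeType_of_mem_algebraicClasses_of_isSmoothProjective
        (IsSmoothProjective.tensor_holds hY (hX.pow (e t))) (cd t) (hγa t))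
      (by push_cast at hlt; omega) hy)
    hc hpp (Submodule.span_le.2 (fun t ht ↦ Submodule.mem_iSup_of_mem (⟨t, ht⟩ : T) (hγt ⟨t, ht⟩)) hcT)
  -- each summand is algebraic
  rw [hsum]
  refine Submodule.sum_mem _ fun t _ ↦ ?_
  exact corrAction_mem_algebraicClasses_complex hY (hX.pow (e t)) (hab t) hk (hγa t)
    ((hpow' (e t)).2 (d t) (a t) (ha t).1 (ha t).2)

/-- **`HC_AV` ALONE implies the Hodge conjecture for every smooth projective variety dominated by the powers
of an abelian variety** — the first conjunct of `hc_of_isDominatedByPowers_abelianVariety`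
(`CorCM/Stage4StrictAbelianType`) with the Arapura record DISCHARGED: no named fact remains besides the
junction `HC_AV`. [cite: Arapura2006, Lemma 4.2 and Lemma 1.1] -/
theorem hc_of_isDominatedByPowers_abelianVariety_self (hAV : HC_AV) (A : AbelianVariety ℂ)
    (hY : IsSmoothProjective dY Y) (hdom : IsDominatedByPowers dY Y A.dim A.X) :
    HodgeConjectureFor dY Y :=
  hodgeConjectureFor_of_isDominatedByPowers AbelianVariety.isSmoothProjective_holds hY hdom
    (hc_pow_abelianVariety_of_hc_av hAV A)

end Dominated

end Summit.HodgeConjecture.CorCM.Stage4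

end
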